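import Summits.QuantumFields.BalabanUV.Beta.GAN24.BornLambdaLift
import Summits.QuantumFields.BalabanUV.Beta.GAN24.BornLambdaLettersPoly

/-!
# `BalabanUV.Beta.GAN24.BornLambdaUndressedRow` — binder row G-an2-4 / (CONV-C), CT-ROUTE, `gen20/BORNSEC-PLAN-v1.md` (Λ-U) ∕ `gen20/LAMBDA-U-RECIPE.md`
# STEPS 4–6: **THE UNDRESSED-LINEAGE LETTER `hUg` OF THE Λ-BORN ROW (leaf-01's `BornLambdaLetters.exists_hBLam_of_geometric_three`) FROM ROAD S3's
# THREE Λ ROWS AT THE IN-BLOCK ROOT** — at `d = 3` and the literal's pin `cE = Lc^4` every weighted undressed Λ-lineage of the comb family (E) is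
# `Lc^4 •` road S3's row-Λ ∕ row-Λt ∕ row-Λ0 object at the same root (`BornLambdaLift` §5 + an exponent identity with the k-FREE residual `Lc^4`,
# refuter Q22), so the per-lineage geometric letter `C·θ^{k−i}`, `θ = Lc⁻¹`, follows from the ROOTED rows `rowL_three_at` ∕ `rowLamTop_at` ∕ `rowL0_holds_at`
# (road S3's `TaylorRowLam.rowL_three` ∕ `TaylorRowLamTop.rowLamTop` ∕ `S3ShapeL0.rowL0_holds` re-run with `hessFF ↦ hessFFAt (toSite r)`; WANTED W5
# «ROOTED-S3-Λ», journal l.34168) — taken here as HYPOTHESES (socket), the member `(i, k) = (0, 1)` discharged inside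

NOT IN PRINT; OUR BOOKKEEPING (row owner `b2b-balaban-gan24-p1`, gen 21; [folklore] over tree theorems BY NAME: the owner's `BornLambdaLift`
(`lineage_succ_eq_e3OfS_lagrIncAt`, `lineage_zero_eq_e3OfS`), leaf-01's `BornLambdaLineage.exists_locStencil_lamPiece_zero` ∕ `unitS_freshAt_lam_zero` and
`BornLambdaLetters.exists_hU_of_geometric` ∕ `exists_hBLam_of_geometric_three`, `Push3.locStencil_push₃_mono` ∕ `Push4Bounds.legDecay_colH`, the owner's g19
`WilsonSectorUndressedRow.colH_KInv_eq_respStep_one`, `StepJetData.locStencil_smul`, `StencilSlotOfShapes.locStencil_mono'`).  0 `def`, 0 cited facts,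
0 `def … : Prop`, 0 sorry.  HONEST FRAMING (cell contract, verbatim): «discharging `BetaPertH` makes Bałaban's UV stability UNCONDITIONAL — a real
constructive-QFT result; it is NOT the continuum limit and NOT the Clay problem.»  HONEST DEPENDENCY (verbatim): «continuum YM on T⁴ ⇐ BetaPertH ∧ nine spine
estimates (0/9 proved); BetaPertH ⇐ (D1) ∧ (D4) ∧ CAP+tail; G-an2-4 gates asym, D1 and NE2/3/4.»  CONDITIONAL: the three rooted rows are HYPOTHESES here
(their `r = 0` instances are the tree theorems `rowL_three` ∕ `rowLamTop` ∕ `rowL0_holds` by `SpineRooted.lagrIncAt_zero` ∕ `hessFFAt_zero`; the in-block-root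
versions are mechanical twins, not yet in the tree).  Discharges NO slot letter by itself; hB OPEN (needs also `hCg` — (C4)–(C6) — and the V half); NEVER
«G-an2-4 closed» as (CONV-C); NOT D1, NOT `BetaPertH`, NOT continuum, NOT Clay.

## What (`Lc` with `[NeZero Lc]`)
* §1 (generic `d`) `e3OfS_smul`; **`exists_locStencil_member_zero_one`** — the lineage born at level `0` read at level `1` (ONE member: `push₃` of the rooted
  one-step Λ-piece through `respStep 1 Lc`), local UNIFORMLY in the in-block root (leaf-01's root-uniform letter for the piece + the `push₃` carrier through the
  decaying one-shot column legs).
* §2 (`d = 3`, pin `cE = Lc^4`) THE EXPONENT IDENTITY (Q22), pointwise: **`lineage_succ_pin_apply`** (birth `j+1`, read `j+n+2`: comb summand `= Lc^4 ·` road S3-L's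
  value at `(n′, m) = (j+n, j)`), **`lineage_top_pin_apply`** (`k = i+1`: `= Lc^4 ·` road S3-Lt's value at `n′ = j`), **`lineage_zero_pin_apply`** (birth `0`, read
  `n+2`: `= Lc^4 ·` road S3-L0's value at `n`) — the residual `Lc^4` is k-FREE and i-FREE (the Wilson sector's constant, `WilsonSectorUndressedRow` §3).
* §3 (`d = 3`) the three comb families as `LocStencil` families from the road rows (`locStencil_lineage_*_of_row`), and **`exists_hUg_of_rootedRows`**: the letter
  `hUg` (`∃ C θ δ, 0 ≤ C ∧ 0 ≤ θ ∧ θ < 1 ∧ 0 < δ ∧ ∀ rr ∈ box, ∀ k i, i < k → LocStencil (summand) (C·θ^{k−i}) δ`, VERBATIM the hypothesis of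
  `BornLambdaLetters.exists_hBLam_of_geometric_three`) from `rowL_three_at` ∧ `rowLamTop_at` ∧ `rowL0_holds_at`, with `θ = Lc⁻¹`,
  `C = Lc·(Lc^4·(max cL 0 + max CtL 0 + c₀L) + max C₀₁ 0)`, `δ` = the minimum of the four rates; **`exists_hU_of_rootedRows`** (leaf-01's `hU`);
  **`exists_hBLam_of_rootedRows`** — the Λ-born row `hB(0, cΛ)` of the `d = 3` comb family from the three rooted rows AND the contact letter `hCg` ((C4)–(C6), open).
* §4 (v1.1) **`exists_hBLam_of_rootedRows_poly`** — the same with a POLY-geometric `hCg` (`C·(k−i)^p·θ^{k−i}`; leaf-03's mixed socket; no rate trade).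
Unit `b2b-balaban-gan24-p1` (row owner G-an2-4, gen 21), 2026-08-21.
-/

noncomputable section

open Finset
open scoped BigOperators
open Literature.MathematicalPhysics.QuantumFieldTheory
open Literature.MathematicalPhysics.QuantumFieldTheory.Balaban1983to89
open Literature.MathematicalPhysics.QuantumFieldTheory.Balaban1983to89.Beta
open ExpKernelCalculus (MKer Decays)
open AffineAveraging (box toSite)
open OneStepResolventKernel (Fib LocStencil KInv decays_KInv)
open OneStepKernelFamily (colH)
open StepJetData (locStencil_smul)
open BalabanStepJets (lamCoeffOf locStencil_mono)
open BalabanCompositeJets (respStep)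
open AveragingHessianKernelsRooted (hessFFAt)
open InterLevelTransport (SLam)
open Summit.QuantumFields.BalabanUV.Beta.HessKerDressedUnits (unitS)
open Summit.QuantumFields.BalabanUV.Beta.SpineRooted (lagrIncAt)
open Summit.QuantumFields.BalabanUV.Beta.GAN24.CombesThomas (sfStep smStep)
open Summit.QuantumFields.BalabanUV.Beta.GAN24.StencilSlotOfShapes (locStencil_mono')
open Summit.QuantumFields.BalabanUV.Beta.GAN24.Push4 (IsFF)
open Summit.QuantumFields.BalabanUV.Beta.GAN24.Push4Bounds (LegDecay legDecay_colH)
open Summit.QuantumFields.BalabanUV.Beta.GAN24.Push4Iter (legChain)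
open Summit.QuantumFields.BalabanUV.Beta.GAN24.Push3 (push₃ cPush₃ locStencil_push₃_mono)
open Summit.QuantumFields.BalabanUV.Beta.GAN24.RespStepBmDecompExact (respStepBmSeq)
open Summit.QuantumFields.BalabanUV.Beta.GAN24.E3UnitSplit (e3OfS)
open Summit.QuantumFields.BalabanUV.Beta.GAN24.ThirdJetKernel (e3OfS_eq_e3K e3K_smul)
open Summit.QuantumFields.BalabanUV.Beta.GAN24.SrecWilsonSector (bornSecAt)
open Summit.QuantumFields.BalabanUV.Beta.GAN24.SrecBornSector (freshAt)
open Summit.QuantumFields.BalabanUV.Beta.GAN24.BornLambdaLineage (unitS_freshAt_lam_zero exists_locStencil_lamPiece_zero)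
open Summit.QuantumFields.BalabanUV.Beta.GAN24.BornLambdaLetters (exists_hU_of_geometric exists_hBLam_of_geometric_three)
open Summit.QuantumFields.BalabanUV.Beta.GAN24.BornLambdaLettersPoly (exists_hBLam_of_geometric_poly_three)
open Summit.QuantumFields.BalabanUV.Beta.GAN24.WilsonSectorUndressedRow (colH_KInv_eq_respStep_one)
open Summit.QuantumFields.BalabanUV.Beta.GAN24.BornLambdaLift (lineage_succ_eq_e3OfS_lagrIncAt lineage_zero_eq_e3OfS)

namespace Summit.QuantumFields.BalabanUV.Beta.GAN24.BornLambdaUndressedRow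

variable {d : ℕ}

/-! ## §1 Linearity of the third-jet functional; the member `(0, 1)` uniformly in the root -/
/-- [folklore] The one-shot third-jet functional is linear in its stencil family (leaf-05's `e3K_smul`). -/
theorem e3OfS_smul {N : ℕ} [NeZero N] (c : ℝ) (S : Fin (d + 1) → (Fin (d + 1) → ℤ) → MKer (d + 1) (Fib d)) (κ' : Fin (d + 1))
    (u' : Fin (d + 1) → ℤ) : e3OfS N (fun κ u => c • S κ u) κ' u' = c • e3OfS N S κ' u' := by
  rw [e3OfS_eq_e3K, e3OfS_eq_e3K, e3K_smul]

section MemberZeroOne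

variable {Lc : ℕ} [NeZero Lc]

/-- NOT IN PRINT; OUR BOOKKEEPING ([folklore]; generic `d`).  **THE LINEAGE BORN AT LEVEL `0` READ AT LEVEL `1` IS A LOCAL STENCIL FAMILY, UNIFORMLY IN
THE IN-BLOCK ROOT**, for every scalar weight `w`: the member `0`'s Λ-piece `cΛ • S^Λ[lamCoeffOf (KInv Lc)] H_ρ` is local with ONE constant and ONE rate for all
roots (leaf-01's `exists_locStencil_lamPiece_zero`), and ONE three-leg push through the decaying one-shot column legs `respStep 1 Lc = colH (KInv Lc) Lc` keeps
locality with an explicit carrier constant (`Push3.locStencil_push₃_mono`). -/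
theorem exists_locStencil_member_zero_one (hLc : 1 ≤ Lc) (w cΛ : ℝ) :
    ∃ C δ : ℝ, 0 < δ ∧ ∀ (rr : Fin (d + 1) → ℕ), rr ∈ box (d + 1) Lc →
      LocStencil (fun κ' u' => w •
        push₃ (respStep (d := d) (Lc ^ 0) (Lc ^ 1)) (respStep (d := d) (Lc ^ 0) (Lc ^ 1)) (respStep (d := d) (Lc ^ 0) (Lc ^ 1))
          (unitS (sfStep Lc 0) (smStep d Lc 0) (freshAt Lc (toSite rr) 0 cΛ 0)) κ' u') C δ := by
  obtain ⟨C0, δ0, hδ0, h0⟩ := exists_locStencil_lamPiece_zero (d := d) hLc cΛ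
  obtain ⟨δK, CK, hδK, -, hK⟩ := decays_KInv (N := Lc ^ 1) (d := d)
  have hδ'0 : 0 < min δ0 (δK / 3) := lt_min hδ0 (by positivity)
  have h2 : 2 * min δ0 (δK / 3) < δK := by linarith [min_le_right δ0 (δK / 3)]
  have hleg : LegDecay (respStep (d := d) (Lc ^ 0) (Lc ^ 1)) (Lc ^ 1) CK δK := by
    rw [pow_zero, ← colH_KInv_eq_respStep_one]
    exact legDecay_colH hK
  have hN : 1 ≤ Lc ^ 1 := by rw [pow_one]; exact hLc
  refine ⟨|w| * (cPush₃ d CK CK CK δK (min δ0 (δK / 3)) * C0), min δ0 (δK / 3), hδ'0, fun rr hrr => ?_⟩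
  have hC0 : 0 ≤ C0 := ((h0 rr hrr) 0 0).nonneg (Sum.inl 0)
  have hS : LocStencil (unitS (sfStep Lc 0) (smStep d Lc 0) (freshAt Lc (toSite rr) 0 cΛ 0)) C0 (min δ0 (δK / 3)) := by
    rw [unitS_freshAt_lam_zero]
    exact locStencil_mono (h0 rr hrr) hC0 (min_le_left _ _)
  exact locStencil_smul w (locStencil_push₃_mono hN hleg hleg hleg hS hδ'0.le h2)

end MemberZeroOne

/-! ## §2 `d = 3`, pin `cE = Lc^4`: the comb summands are `Lc^4 ·` road S3's rooted row objects (the exponent identity, Q22) -/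

section Pin

variable {Lc : ℕ} [NeZero Lc]

/-- NOT IN PRINT; OUR BOOKKEEPING ([folklore]; Q22's exponent identity for road S3-L ∕ S3-Lt).  **BIRTH `j+1`, READ `j+n+2`**: pointwise, the weighted undressed
comb lineage equals `Lc^4` times road S3's row-Λ value at `(n′, m) = (j+n, j)` and the same in-block root:
`(cE·Lc^8)^{n+1}·push₃ B³ X_{j+1} = Lc^4 · [(Lc^(j+n+2))^8 · e3OfS (Lc^(j+n+2)) (((Lc^4)^{(j+n)−j}·cΛ·(Lc^(j+1))^{10}) • lagrIncAt 3 ρ Lc (Lc^(j+1)) (Lc^(j+2)))]`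
(`Lc^{12(n+1)}·Lc^{18(j+1)} = Lc^4·Lc^{8(j+n+2)}·Lc^{4n}·Lc^{10(j+1)}`). -/
theorem lineage_succ_pin_apply (hLc : 1 ≤ Lc) {rr : Fin (3 + 1) → ℕ} (hrr : rr ∈ box (3 + 1) Lc) {cE : ℝ} (hcE : cE = (Lc : ℝ) ^ (3 + 1))
    (cΛ : ℝ) (j n : ℕ) (κ' : Fin (3 + 1)) (u' x' z' : Fin (3 + 1) → ℤ) (a b : Fib 3) :
    ((cE * (Lc : ℝ) ^ (2 * (3 + 1))) ^ (n + 1) •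
        push₃ (respStep (d := 3) (Lc ^ (j + 1)) (Lc ^ (j + n + 1 + 1))) (respStep (d := 3) (Lc ^ (j + 1)) (Lc ^ (j + n + 1 + 1)))
          (respStep (d := 3) (Lc ^ (j + 1)) (Lc ^ (j + n + 1 + 1)))
          (unitS (sfStep Lc (j + 1)) (smStep 3 Lc (j + 1)) (freshAt Lc (toSite rr) 0 cΛ (j + 1))) κ' u') x' z' a b
      = (Lc : ℝ) ^ (3 + 1) * (((Lc : ℝ) ^ (j + n + 1 + 1)) ^ (2 * (3 + 1)) *
          e3OfS (Lc ^ (j + n + 1 + 1)) (fun κ u => (((Lc : ℝ) ^ (3 + 1)) ^ (j + n - j) * (cΛ * ((Lc : ℝ) ^ (j + 1)) ^ (2 * 3 + 4))) •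
            lagrIncAt 3 (toSite rr) Lc (Lc ^ (j + 1)) (Lc ^ (j + 1 + 1)) κ u) κ' u' x' z' a b) := by
  rw [Pi.smul_apply, Pi.smul_apply, Pi.smul_apply, Pi.smul_apply, smul_eq_mul, lineage_succ_eq_e3OfS_lagrIncAt (d := 3) hLc hrr cΛ j n κ' u',
    e3OfS_smul, e3OfS_smul, Pi.smul_apply, Pi.smul_apply, Pi.smul_apply, Pi.smul_apply, smul_eq_mul, Pi.smul_apply, Pi.smul_apply,
    Pi.smul_apply, Pi.smul_apply, smul_eq_mul, Nat.add_sub_cancel_left]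
  subst hcE
  ring

/-- NOT IN PRINT; OUR BOOKKEEPING ([folklore]; the top member `k = i+1`).  **BIRTH `j+1`, READ `j+2`**: the weighted comb lineage (ONE push) equals `Lc^4`
times road S3's row-Λt value at `n′ = j`: `(cE·Lc^8)·push₃ B³ X_{j+1} = Lc^4 · [(Lc^(j+2))^8 · e3OfS (Lc^(j+2)) ((cΛ·(Lc^(j+1))^{10}) • lagrIncAt 3 ρ Lc (Lc^(j+1)) (Lc^(j+2)))]`. -/
theorem lineage_top_pin_apply (hLc : 1 ≤ Lc) {rr : Fin (3 + 1) → ℕ} (hrr : rr ∈ box (3 + 1) Lc) {cE : ℝ} (hcE : cE = (Lc : ℝ) ^ (3 + 1))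
    (cΛ : ℝ) (j : ℕ) (κ' : Fin (3 + 1)) (u' x' z' : Fin (3 + 1) → ℤ) (a b : Fib 3) :
    ((cE * (Lc : ℝ) ^ (2 * (3 + 1))) ^ 1 •
        push₃ (respStep (d := 3) (Lc ^ (j + 1)) (Lc ^ (j + 1 + 1))) (respStep (d := 3) (Lc ^ (j + 1)) (Lc ^ (j + 1 + 1)))
          (respStep (d := 3) (Lc ^ (j + 1)) (Lc ^ (j + 1 + 1)))
          (unitS (sfStep Lc (j + 1)) (smStep 3 Lc (j + 1)) (freshAt Lc (toSite rr) 0 cΛ (j + 1))) κ' u') x' z' a b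
      = (Lc : ℝ) ^ (3 + 1) * (((Lc : ℝ) ^ (j + 1 + 1)) ^ (2 * (3 + 1)) *
          e3OfS (Lc ^ (j + 1 + 1)) (fun κ u => (cΛ * ((Lc : ℝ) ^ (j + 1)) ^ (2 * 3 + 4)) •
            lagrIncAt 3 (toSite rr) Lc (Lc ^ (j + 1)) (Lc ^ (j + 1 + 1)) κ u) κ' u' x' z' a b) := by
  have h := lineage_succ_eq_e3OfS_lagrIncAt (d := 3) hLc hrr cΛ j 0 κ' u'
  simp only [Nat.add_zero] at h
  rw [Pi.smul_apply, Pi.smul_apply, Pi.smul_apply, Pi.smul_apply, smul_eq_mul, h, e3OfS_smul, e3OfS_smul, Pi.smul_apply, Pi.smul_apply,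
    Pi.smul_apply, Pi.smul_apply, smul_eq_mul, Pi.smul_apply, Pi.smul_apply, Pi.smul_apply, Pi.smul_apply, smul_eq_mul]
  subst hcE
  ring

/-- NOT IN PRINT; OUR BOOKKEEPING ([folklore]; Q22's exponent identity for road S3-L0).  **BIRTH `0`, READ `n+2`**: the weighted comb lineage equals `Lc^4` times
road S3's row-Λ0 value at `n`: `(cE·Lc^8)^{n+2}·push₃ B³ X_0 = Lc^4 · [(Lc^(n+2))^8 · e3OfS (Lc^(n+2)) (((Lc^4)^{n+1}·cΛ) • S^Λ[lamCoeffOf (KInv Lc)] H_ρ)]`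
(`Lc^{12(n+2)} = Lc^4·Lc^{8(n+2)}·Lc^{4(n+1)}`). -/
theorem lineage_zero_pin_apply {cE : ℝ} (hcE : cE = (Lc : ℝ) ^ (3 + 1)) (rr : Fin (3 + 1) → ℕ) (cΛ : ℝ) (n : ℕ) (κ' : Fin (3 + 1))
    (u' x' z' : Fin (3 + 1) → ℤ) (a b : Fib 3) :
    ((cE * (Lc : ℝ) ^ (2 * (3 + 1))) ^ (n + 1 + 1) •
        push₃ (respStep (d := 3) (Lc ^ 0) (Lc ^ (n + 1 + 1))) (respStep (d := 3) (Lc ^ 0) (Lc ^ (n + 1 + 1)))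
          (respStep (d := 3) (Lc ^ 0) (Lc ^ (n + 1 + 1)))
          (unitS (sfStep Lc 0) (smStep 3 Lc 0) (freshAt Lc (toSite rr) 0 cΛ 0)) κ' u') x' z' a b
      = (Lc : ℝ) ^ (3 + 1) * (((Lc : ℝ) ^ (n + 1 + 1)) ^ (2 * (3 + 1)) *
          e3OfS (Lc ^ (n + 1 + 1)) (fun κ u => (((Lc : ℝ) ^ (3 + 1)) ^ (n + 1) * cΛ) •
            SLam Lc (lamCoeffOf (KInv (N := Lc) (d := 3)) Lc) (fun μ y => hessFFAt (toSite rr) Lc μ y) κ u) κ' u' x' z' a b) := by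
  rw [Pi.smul_apply, Pi.smul_apply, Pi.smul_apply, Pi.smul_apply, smul_eq_mul, lineage_zero_eq_e3OfS (d := 3) (toSite rr) cΛ (n + 1 + 1) κ' u',
    e3OfS_smul, e3OfS_smul, Pi.smul_apply, Pi.smul_apply, Pi.smul_apply, Pi.smul_apply, smul_eq_mul, Pi.smul_apply, Pi.smul_apply,
    Pi.smul_apply, Pi.smul_apply, smul_eq_mul]
  subst hcE
  ring

end Pin

/-! ## §3 `d = 3`: the undressed-lineage letter `hUg` from road S3's three Λ rows at the in-block root -/

section Socket

variable {Lc : ℕ} [NeZero Lc]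

/-- NOT IN PRINT; OUR BOOKKEEPING ([folklore]).  A local-stencil letter for road S3-L's rooted value at `(n′, m) = (j+n, j)` gives one for the comb summand
(birth `j+1`, read `j+n+2`), constant `× Lc^4`. -/
theorem locStencil_lineage_succ_of_row (hLc : 1 ≤ Lc) {rr : Fin (3 + 1) → ℕ} (hrr : rr ∈ box (3 + 1) Lc) {cE : ℝ} (hcE : cE = (Lc : ℝ) ^ (3 + 1))
    (cΛ : ℝ) (j n : ℕ) {c δ : ℝ}
    (h : LocStencil (fun κ' u' x' z' a b => ((Lc : ℝ) ^ (j + n + 1 + 1)) ^ (2 * (3 + 1)) *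
      e3OfS (Lc ^ (j + n + 1 + 1)) (fun κ u => (((Lc : ℝ) ^ (3 + 1)) ^ (j + n - j) * (cΛ * ((Lc : ℝ) ^ (j + 1)) ^ (2 * 3 + 4))) •
        lagrIncAt 3 (toSite rr) Lc (Lc ^ (j + 1)) (Lc ^ (j + 1 + 1)) κ u) κ' u' x' z' a b) c δ) :
    LocStencil (fun κ' u' => (cE * (Lc : ℝ) ^ (2 * (3 + 1))) ^ (n + 1) •
        push₃ (respStep (d := 3) (Lc ^ (j + 1)) (Lc ^ (j + n + 1 + 1))) (respStep (d := 3) (Lc ^ (j + 1)) (Lc ^ (j + n + 1 + 1)))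
          (respStep (d := 3) (Lc ^ (j + 1)) (Lc ^ (j + n + 1 + 1)))
          (unitS (sfStep Lc (j + 1)) (smStep 3 Lc (j + 1)) (freshAt Lc (toSite rr) 0 cΛ (j + 1))) κ' u') ((Lc : ℝ) ^ (3 + 1) * c) δ := by
  intro κ' u' x' z' a b
  have hx := h κ' u' x' z' a b
  beta_reduce at hx
  beta_reduce
  rw [lineage_succ_pin_apply hLc hrr hcE cΛ j n κ' u' x' z' a b, abs_mul, abs_of_nonneg (by positivity : (0 : ℝ) ≤ (Lc : ℝ) ^ (3 + 1)), mul_assoc]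
  exact mul_le_mul_of_nonneg_left hx (by positivity)

/-- NOT IN PRINT; OUR BOOKKEEPING ([folklore]).  The same for the top member (road S3-Lt's rooted value at `n′ = j`; birth `j+1`, read `j+2`). -/
theorem locStencil_lineage_top_of_row (hLc : 1 ≤ Lc) {rr : Fin (3 + 1) → ℕ} (hrr : rr ∈ box (3 + 1) Lc) {cE : ℝ} (hcE : cE = (Lc : ℝ) ^ (3 + 1))
    (cΛ : ℝ) (j : ℕ) {c δ : ℝ}
    (h : LocStencil (fun κ' u' x' z' a b => ((Lc : ℝ) ^ (j + 1 + 1)) ^ (2 * (3 + 1)) *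
      e3OfS (Lc ^ (j + 1 + 1)) (fun κ u => (cΛ * ((Lc : ℝ) ^ (j + 1)) ^ (2 * 3 + 4)) •
        lagrIncAt 3 (toSite rr) Lc (Lc ^ (j + 1)) (Lc ^ (j + 1 + 1)) κ u) κ' u' x' z' a b) c δ) :
    LocStencil (fun κ' u' => (cE * (Lc : ℝ) ^ (2 * (3 + 1))) ^ 1 •
        push₃ (respStep (d := 3) (Lc ^ (j + 1)) (Lc ^ (j + 1 + 1))) (respStep (d := 3) (Lc ^ (j + 1)) (Lc ^ (j + 1 + 1)))
          (respStep (d := 3) (Lc ^ (j + 1)) (Lc ^ (j + 1 + 1)))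
          (unitS (sfStep Lc (j + 1)) (smStep 3 Lc (j + 1)) (freshAt Lc (toSite rr) 0 cΛ (j + 1))) κ' u') ((Lc : ℝ) ^ (3 + 1) * c) δ := by
  intro κ' u' x' z' a b
  have hx := h κ' u' x' z' a b
  beta_reduce at hx
  beta_reduce
  rw [lineage_top_pin_apply hLc hrr hcE cΛ j κ' u' x' z' a b, abs_mul, abs_of_nonneg (by positivity : (0 : ℝ) ≤ (Lc : ℝ) ^ (3 + 1)), mul_assoc]
  exact mul_le_mul_of_nonneg_left hx (by positivity)

/-- NOT IN PRINT; OUR BOOKKEEPING ([folklore]).  The same for the birth-`0` lineages (road S3-L0's rooted value at `n`; read `n+2`). -/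
theorem locStencil_lineage_zero_of_row {rr : Fin (3 + 1) → ℕ} {cE : ℝ} (hcE : cE = (Lc : ℝ) ^ (3 + 1)) (cΛ : ℝ) (n : ℕ) {c δ : ℝ}
    (h : LocStencil (fun κ' u' x' z' a b => ((Lc : ℝ) ^ (n + 1 + 1)) ^ (2 * (3 + 1)) *
      e3OfS (Lc ^ (n + 1 + 1)) (fun κ u => (((Lc : ℝ) ^ (3 + 1)) ^ (n + 1) * cΛ) •
        SLam Lc (lamCoeffOf (KInv (N := Lc) (d := 3)) Lc) (fun μ y => hessFFAt (toSite rr) Lc μ y) κ u) κ' u' x' z' a b) c δ) :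
    LocStencil (fun κ' u' => (cE * (Lc : ℝ) ^ (2 * (3 + 1))) ^ (n + 1 + 1) •
        push₃ (respStep (d := 3) (Lc ^ 0) (Lc ^ (n + 1 + 1))) (respStep (d := 3) (Lc ^ 0) (Lc ^ (n + 1 + 1)))
          (respStep (d := 3) (Lc ^ 0) (Lc ^ (n + 1 + 1)))
          (unitS (sfStep Lc 0) (smStep 3 Lc 0) (freshAt Lc (toSite rr) 0 cΛ 0)) κ' u') ((Lc : ℝ) ^ (3 + 1) * c) δ := by
  intro κ' u' x' z' a b
  have hx := h κ' u' x' z' a b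
  beta_reduce at hx
  beta_reduce
  rw [lineage_zero_pin_apply hcE rr cΛ n κ' u' x' z' a b, abs_mul, abs_of_nonneg (by positivity : (0 : ℝ) ≤ (Lc : ℝ) ^ (3 + 1)), mul_assoc]
  exact mul_le_mul_of_nonneg_left hx (by positivity)

/-- NOT IN PRINT; OUR PROOF ATTEMPT — CONDITIONAL on road S3's three Λ rows AT THE IN-BLOCK ROOT ([folklore] assembly).  **THE UNDRESSED-LINEAGE LETTER
`hUg` OF THE Λ-BORN ROW** (`d = 3`, `2 ≤ Lc`, the literal's pin `cE = Lc^4`): from the rooted rows `rowL_three_at` (S3-L: birth `m+1 ≥ 1`, read `n+2 ≥ m+3`,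
constant `cL·(Lc⁻¹)^{n−m}`), `rowLamTop_at` (S3-Lt: read one level above birth, constant `CtL`) and `rowL0_holds_at` (S3-L0: birth `0`, read `n+2`, constant
`c₀L·(Lc⁻¹)^{n+1}`) — each with ONE constant and ONE rate BEFORE the in-block root — every weighted undressed Λ-lineage of the comb family,
`(cE·Lc^8)^{k−i} • push₃ (respStep (Lc^i) (Lc^k))³ (unitS_i (freshAt Lc ρ 0 cΛ i))`, `i < k`, is a local stencil family with constant `C·θ^{k−i}`, `θ = Lc⁻¹ < 1`,
`C = Lc·(Lc^4·(max cL 0 + max CtL 0 + c₀L) + max C₀₁ 0)`, at the minimum rate — VERBATIM the hypothesis `hUg` of `BornLambdaLetters.exists_hBLam_of_geometric_three`.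
The member `(i, k) = (0, 1)` is §1; the three rooted rows are the WANTED twins of road S3's tree rows (W5 «ROOTED-S3-Λ»); NOTHING of them is claimed here. -/
theorem exists_hUg_of_rootedRows (hLc : 2 ≤ Lc) {cE : ℝ} (hcE : cE = (Lc : ℝ) ^ (3 + 1)) (cΛ : ℝ)
    (hL : ∃ cL δL : ℝ, 0 < δL ∧ ∀ (r : Fin (3 + 1) → ℕ), r ∈ box (3 + 1) Lc → ∀ n m : ℕ, m < n →
      LocStencil (fun κ' u' x' z' a b => ((Lc : ℝ) ^ (n + 1 + 1)) ^ (2 * (3 + 1)) *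
        e3OfS (Lc ^ (n + 1 + 1)) (fun κ u => (((Lc : ℝ) ^ (3 + 1)) ^ (n - m) * (cΛ * ((Lc : ℝ) ^ (m + 1)) ^ (2 * 3 + 4))) •
          lagrIncAt 3 (toSite r) Lc (Lc ^ (m + 1)) (Lc ^ (m + 1 + 1)) κ u) κ' u' x' z' a b) (cL * ((Lc : ℝ)⁻¹) ^ (n - m)) δL)
    (hLt : ∃ CtL δt : ℝ, 0 < δt ∧ ∀ (r : Fin (3 + 1) → ℕ), r ∈ box (3 + 1) Lc → ∀ n : ℕ,
      LocStencil (fun κ' u' x' z' a b => ((Lc : ℝ) ^ (n + 1 + 1)) ^ (2 * (3 + 1)) *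
        e3OfS (Lc ^ (n + 1 + 1)) (fun κ u => (cΛ * ((Lc : ℝ) ^ (n + 1)) ^ (2 * 3 + 4)) •
          lagrIncAt 3 (toSite r) Lc (Lc ^ (n + 1)) (Lc ^ (n + 1 + 1)) κ u) κ' u' x' z' a b) CtL δt)
    (hL0 : ∃ c₀L δ0 : ℝ, 0 ≤ c₀L ∧ 0 < δ0 ∧ ∀ (r : Fin (3 + 1) → ℕ), r ∈ box (3 + 1) Lc → ∀ n : ℕ,
      LocStencil (fun κ' u' x' z' a b => ((Lc : ℝ) ^ (n + 1 + 1)) ^ (2 * (3 + 1)) *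
        e3OfS (Lc ^ (n + 1 + 1)) (fun κ u => (((Lc : ℝ) ^ (3 + 1)) ^ (n + 1) * cΛ) •
          SLam Lc (lamCoeffOf (KInv (N := Lc) (d := 3)) Lc) (fun μ y => hessFFAt (toSite r) Lc μ y) κ u) κ' u' x' z' a b)
        (c₀L * ((Lc : ℝ)⁻¹) ^ (n + 1)) δ0) :
    ∃ C θ δ : ℝ, 0 ≤ C ∧ 0 ≤ θ ∧ θ < 1 ∧ 0 < δ ∧ ∀ (rr : Fin (3 + 1) → ℕ), rr ∈ box (3 + 1) Lc → ∀ k i : ℕ, i < k →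
      LocStencil (fun κ' u' => (cE * (Lc : ℝ) ^ (2 * (3 + 1))) ^ (k - i) •
        push₃ (respStep (d := 3) (Lc ^ i) (Lc ^ k)) (respStep (d := 3) (Lc ^ i) (Lc ^ k)) (respStep (d := 3) (Lc ^ i) (Lc ^ k))
          (unitS (sfStep Lc i) (smStep 3 Lc i) (freshAt Lc (toSite rr) 0 cΛ i)) κ' u') (C * θ ^ (k - i)) δ := by
  have hLc1 : 1 ≤ Lc := le_trans (by norm_num) hLc
  have hLpos : (0 : ℝ) < Lc := by exact_mod_cast Nat.pos_of_ne_zero (NeZero.ne Lc)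
  have hL1 : (1 : ℝ) < Lc := by exact_mod_cast (lt_of_lt_of_le (by norm_num) hLc : 1 < Lc)
  obtain ⟨cL, δL, hδL, hL⟩ := hL
  obtain ⟨CtL, δt, hδt, hLt⟩ := hLt
  obtain ⟨c₀L, δ0, hc₀L, hδ0, hL0r⟩ := hL0
  obtain ⟨C01, δ01, hδ01, h01⟩ := exists_locStencil_member_zero_one (d := 3) hLc1 ((cE * (Lc : ℝ) ^ (2 * (3 + 1))) ^ 1) cΛ
  -- the constants
  set A : ℝ := (Lc : ℝ) ^ (3 + 1) with hA
  set Y : ℝ := A * (max cL 0 + max CtL 0 + c₀L) + max C01 0 with hY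
  have hA0 : 0 ≤ A := by positivity
  have hY0 : 0 ≤ Y := by positivity
  have hθ0 : 0 ≤ (Lc : ℝ)⁻¹ := by positivity
  have hθ1 : (Lc : ℝ)⁻¹ < 1 := inv_lt_one_of_one_lt₀ hL1
  have hkey : ∀ m : ℕ, (Lc : ℝ) * Y * ((Lc : ℝ)⁻¹) ^ (m + 1) = Y * ((Lc : ℝ)⁻¹) ^ m := by
    intro m
    rw [pow_succ]
    field_simp
  refine ⟨(Lc : ℝ) * Y, (Lc : ℝ)⁻¹, min (min δL δt) (min δ0 δ01), by positivity, hθ0, hθ1,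
    lt_min (lt_min hδL hδt) (lt_min hδ0 hδ01), fun rr hrr k i hik => ?_⟩
  obtain ⟨n, rfl⟩ := Nat.exists_eq_add_of_lt hik
  cases i with
  | zero =>
    cases n with
    | zero =>
      -- the member (0, 1)
      rw [show 0 + 0 + 1 = 1 by rfl, show 1 - 0 = 1 by rfl]
      refine locStencil_mono' (h01 rr hrr) ?_ ((min_le_right _ _).trans (min_le_right _ _))
      rw [show (1 : ℕ) = 0 + 1 by rfl, hkey 0, pow_zero, mul_one]
      exact (le_max_left _ _).trans (le_add_of_nonneg_left (by positivity))
    | succ n =>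
      -- birth 0, read n + 2: road S3-L0 at the root
      rw [show 0 + (n + 1) + 1 = n + 1 + 1 by omega, show n + 1 + 1 - 0 = n + 1 + 1 by omega]
      refine locStencil_mono' (locStencil_lineage_zero_of_row hcE cΛ n (hL0r rr hrr n)) ?_ ((min_le_right _ _).trans (min_le_left _ _))
      rw [hkey (n + 1), ← mul_assoc]
      refine mul_le_mul_of_nonneg_right ?_ (pow_nonneg hθ0 _)
      have hb : c₀L ≤ max cL 0 + max CtL 0 + c₀L := by linarith [le_max_right cL 0, le_max_right CtL 0]
      calc A * c₀L ≤ A * (max cL 0 + max CtL 0 + c₀L) := mul_le_mul_of_nonneg_left hb hA0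
        _ ≤ Y := le_add_of_nonneg_right (le_max_right _ _)
  | succ j =>
    cases n with
    | zero =>
      -- birth j + 1, read j + 2: road S3-Lt at the root
      rw [show j + 1 + 0 + 1 = j + 1 + 1 by omega, show j + 1 + 1 - (j + 1) = 1 by omega]
      refine locStencil_mono' (locStencil_lineage_top_of_row hLc1 hrr hcE cΛ j (hLt rr hrr j)) ?_ ((min_le_left _ _).trans (min_le_right _ _))
      rw [show (1 : ℕ) = 0 + 1 by rfl, hkey 0, pow_zero, mul_one]
      have hb : CtL ≤ max cL 0 + max CtL 0 + c₀L := by linarith [le_max_left CtL 0, le_max_right cL 0, hc₀L]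
      calc A * CtL ≤ A * (max cL 0 + max CtL 0 + c₀L) := mul_le_mul_of_nonneg_left hb hA0
        _ ≤ Y := le_add_of_nonneg_right (le_max_right _ _)
    | succ n =>
      -- birth j + 1, read j + n + 3: road S3-L at the root, (n′, m) = (j + n + 1, j)
      rw [show j + 1 + (n + 1) + 1 = j + (n + 1) + 1 + 1 by omega, show j + (n + 1) + 1 + 1 - (j + 1) = n + 1 + 1 by omega]
      refine locStencil_mono' (locStencil_lineage_succ_of_row hLc1 hrr hcE cΛ j (n + 1) (hL rr hrr (j + (n + 1)) j (by omega))) ?_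
        ((min_le_left _ _).trans (min_le_left _ _))
      rw [Nat.add_sub_cancel_left, hkey (n + 1), ← mul_assoc]
      refine mul_le_mul_of_nonneg_right ?_ (pow_nonneg hθ0 _)
      have hb : cL ≤ max cL 0 + max CtL 0 + c₀L := by linarith [le_max_left cL 0, le_max_right CtL 0, hc₀L]
      calc A * cL ≤ A * (max cL 0 + max CtL 0 + c₀L) := mul_le_mul_of_nonneg_left hb hA0
        _ ≤ Y := le_add_of_nonneg_right (le_max_right _ _)

/-- NOT IN PRINT; OUR BOOKKEEPING ([folklore]; CONDITIONAL on the three rooted rows).  **leaf-01's letter `hU`** (the SUM over the birth levels) of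
`BornLambdaLineage.exists_hBLam_of_letters_three`, from the rooted rows (`exists_hUg_of_rootedRows` + `BornLambdaLetters.exists_hU_of_geometric`). -/
theorem exists_hU_of_rootedRows (hLc : 2 ≤ Lc) {cE : ℝ} (hcE : cE = (Lc : ℝ) ^ (3 + 1)) (cΛ : ℝ)
    (hL : ∃ cL δL : ℝ, 0 < δL ∧ ∀ (r : Fin (3 + 1) → ℕ), r ∈ box (3 + 1) Lc → ∀ n m : ℕ, m < n →
      LocStencil (fun κ' u' x' z' a b => ((Lc : ℝ) ^ (n + 1 + 1)) ^ (2 * (3 + 1)) *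
        e3OfS (Lc ^ (n + 1 + 1)) (fun κ u => (((Lc : ℝ) ^ (3 + 1)) ^ (n - m) * (cΛ * ((Lc : ℝ) ^ (m + 1)) ^ (2 * 3 + 4))) •
          lagrIncAt 3 (toSite r) Lc (Lc ^ (m + 1)) (Lc ^ (m + 1 + 1)) κ u) κ' u' x' z' a b) (cL * ((Lc : ℝ)⁻¹) ^ (n - m)) δL)
    (hLt : ∃ CtL δt : ℝ, 0 < δt ∧ ∀ (r : Fin (3 + 1) → ℕ), r ∈ box (3 + 1) Lc → ∀ n : ℕ,
      LocStencil (fun κ' u' x' z' a b => ((Lc : ℝ) ^ (n + 1 + 1)) ^ (2 * (3 + 1)) *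
        e3OfS (Lc ^ (n + 1 + 1)) (fun κ u => (cΛ * ((Lc : ℝ) ^ (n + 1)) ^ (2 * 3 + 4)) •
          lagrIncAt 3 (toSite r) Lc (Lc ^ (n + 1)) (Lc ^ (n + 1 + 1)) κ u) κ' u' x' z' a b) CtL δt)
    (hL0 : ∃ c₀L δ0 : ℝ, 0 ≤ c₀L ∧ 0 < δ0 ∧ ∀ (r : Fin (3 + 1) → ℕ), r ∈ box (3 + 1) Lc → ∀ n : ℕ,
      LocStencil (fun κ' u' x' z' a b => ((Lc : ℝ) ^ (n + 1 + 1)) ^ (2 * (3 + 1)) *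
        e3OfS (Lc ^ (n + 1 + 1)) (fun κ u => (((Lc : ℝ) ^ (3 + 1)) ^ (n + 1) * cΛ) •
          SLam Lc (lamCoeffOf (KInv (N := Lc) (d := 3)) Lc) (fun μ y => hessFFAt (toSite r) Lc μ y) κ u) κ' u' x' z' a b)
        (c₀L * ((Lc : ℝ)⁻¹) ^ (n + 1)) δ0) :
    ∃ C δ : ℝ, 0 < δ ∧ ∀ (rr : Fin (3 + 1) → ℕ), rr ∈ box (3 + 1) Lc → ∀ k : ℕ,
      LocStencil (∑ i ∈ Finset.range k, fun κ' u' => (cE * (Lc : ℝ) ^ (2 * (3 + 1))) ^ (k - i) •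
        push₃ (respStep (d := 3) (Lc ^ i) (Lc ^ k)) (respStep (d := 3) (Lc ^ i) (Lc ^ k)) (respStep (d := 3) (Lc ^ i) (Lc ^ k))
          (unitS (sfStep Lc i) (smStep 3 Lc i) (freshAt Lc (toSite rr) 0 cΛ i)) κ' u') C δ :=
  exists_hU_of_geometric (d := 3) cE cΛ (exists_hUg_of_rootedRows hLc hcE cΛ hL hLt hL0)

/-- NOT IN PRINT; OUR PROOF ATTEMPT — CONDITIONAL ([folklore] assembly).  **THE Λ-BORN ROW `hB(0, cΛ)` OF THE `d = 3` COMB FAMILY AT THE PIN `cE = Lc^4` FROM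
ROAD S3's THREE Λ ROWS AT THE IN-BLOCK ROOT AND THE CONTACT LETTER `hCg`** (leaf-01's `exists_hBLam_of_geometric_three` with `hUg` supplied by
`exists_hUg_of_rootedRows`): what remains OPEN for the Λ half of hB is exactly (i) the three rooted rows (mechanical twins of tree theorems, W5) and (ii) the
per-lineage contact letter `hCg` (BORNSEC-PLAN v1.1 (C4)–(C6)).  NOT hB (the V half is separate), NOT hS0-comb, NEVER «G-an2-4 closed». -/
theorem exists_hBLam_of_rootedRows (hLc : 2 ≤ Lc) {cE : ℝ} (hcE : cE = (Lc : ℝ) ^ (3 + 1)) (cΛ : ℝ)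
    (hL : ∃ cL δL : ℝ, 0 < δL ∧ ∀ (r : Fin (3 + 1) → ℕ), r ∈ box (3 + 1) Lc → ∀ n m : ℕ, m < n →
      LocStencil (fun κ' u' x' z' a b => ((Lc : ℝ) ^ (n + 1 + 1)) ^ (2 * (3 + 1)) *
        e3OfS (Lc ^ (n + 1 + 1)) (fun κ u => (((Lc : ℝ) ^ (3 + 1)) ^ (n - m) * (cΛ * ((Lc : ℝ) ^ (m + 1)) ^ (2 * 3 + 4))) •
          lagrIncAt 3 (toSite r) Lc (Lc ^ (m + 1)) (Lc ^ (m + 1 + 1)) κ u) κ' u' x' z' a b) (cL * ((Lc : ℝ)⁻¹) ^ (n - m)) δL)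
    (hLt : ∃ CtL δt : ℝ, 0 < δt ∧ ∀ (r : Fin (3 + 1) → ℕ), r ∈ box (3 + 1) Lc → ∀ n : ℕ,
      LocStencil (fun κ' u' x' z' a b => ((Lc : ℝ) ^ (n + 1 + 1)) ^ (2 * (3 + 1)) *
        e3OfS (Lc ^ (n + 1 + 1)) (fun κ u => (cΛ * ((Lc : ℝ) ^ (n + 1)) ^ (2 * 3 + 4)) •
          lagrIncAt 3 (toSite r) Lc (Lc ^ (n + 1)) (Lc ^ (n + 1 + 1)) κ u) κ' u' x' z' a b) CtL δt)
    (hL0 : ∃ c₀L δ0 : ℝ, 0 ≤ c₀L ∧ 0 < δ0 ∧ ∀ (r : Fin (3 + 1) → ℕ), r ∈ box (3 + 1) Lc → ∀ n : ℕ,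
      LocStencil (fun κ' u' x' z' a b => ((Lc : ℝ) ^ (n + 1 + 1)) ^ (2 * (3 + 1)) *
        e3OfS (Lc ^ (n + 1 + 1)) (fun κ u => (((Lc : ℝ) ^ (3 + 1)) ^ (n + 1) * cΛ) •
          SLam Lc (lamCoeffOf (KInv (N := Lc) (d := 3)) Lc) (fun μ y => hessFFAt (toSite r) Lc μ y) κ u) κ' u' x' z' a b)
        (c₀L * ((Lc : ℝ)⁻¹) ^ (n + 1)) δ0)
    (hCg : ∃ C θ δ : ℝ, 0 ≤ C ∧ 0 ≤ θ ∧ θ < 1 ∧ 0 < δ ∧ ∀ (rr : Fin (3 + 1) → ℕ), rr ∈ box (3 + 1) Lc → ∀ k i : ℕ, i < k →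
      LocStencil (fun κ' u' => (cE * (Lc : ℝ) ^ (2 * (3 + 1))) ^ (k - i) •
        (push₃ (legChain (respStepBmSeq (toSite rr) Lc) i (k - 1 - i)) (legChain (respStepBmSeq (toSite rr) Lc) i (k - 1 - i))
            (legChain (respStepBmSeq (toSite rr) Lc) i (k - 1 - i)) (unitS (sfStep Lc i) (smStep 3 Lc i) (freshAt Lc (toSite rr) 0 cΛ i)) κ' u'
          - push₃ (respStep (d := 3) (Lc ^ i) (Lc ^ k)) (respStep (d := 3) (Lc ^ i) (Lc ^ k)) (respStep (d := 3) (Lc ^ i) (Lc ^ k))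
            (unitS (sfStep Lc i) (smStep 3 Lc i) (freshAt Lc (toSite rr) 0 cΛ i)) κ' u')) (C * θ ^ (k - i)) δ) :
    ∃ C δ : ℝ, 0 < δ ∧ ∀ (rr : Fin (3 + 1) → ℕ), rr ∈ box (3 + 1) Lc →
      ∀ k : ℕ, LocStencil (unitS (sfStep Lc k) (smStep 3 Lc k) (bornSecAt Lc (toSite rr) cE 0 cΛ k)) C δ :=
  exists_hBLam_of_geometric_three cE cΛ (exists_hUg_of_rootedRows hLc hcE cΛ hL hLt hL0) hCg

end Socket

/-! ## §4 The mixed socket: rooted rows + a poly-geometric contact letter (v1.1, append-only) -/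
/-- NOT IN PRINT; OUR PROOF ATTEMPT — CONDITIONAL ([folklore] one-line assembly).  **THE Λ-BORN ROW FROM THE THREE ROOTED ROWS AND A POLY-GEOMETRIC CONTACT
LETTER** `C·(k−i)^p·θ^{k−i}` (the (C4)∕(C6) END currency; leaf-03's mixed socket `exists_hBLam_of_geometric_poly_three` with `hUg := exists_hUg_of_rootedRows`). -/
theorem exists_hBLam_of_rootedRows_poly {Lc : ℕ} [NeZero Lc] (hLc : 2 ≤ Lc) {cE : ℝ} (hcE : cE = (Lc : ℝ) ^ (3 + 1)) (cΛ : ℝ) (p : ℕ)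
    (hL : ∃ cL δL : ℝ, 0 < δL ∧ ∀ (r : Fin (3 + 1) → ℕ), r ∈ box (3 + 1) Lc → ∀ n m : ℕ, m < n →
      LocStencil (fun κ' u' x' z' a b => ((Lc : ℝ) ^ (n + 1 + 1)) ^ (2 * (3 + 1)) * e3OfS (Lc ^ (n + 1 + 1)) (fun κ u =>
        (((Lc : ℝ) ^ (3 + 1)) ^ (n - m) * (cΛ * ((Lc : ℝ) ^ (m + 1)) ^ (2 * 3 + 4))) • lagrIncAt 3 (toSite r) Lc (Lc ^ (m + 1)) (Lc ^ (m + 1 + 1)) κ u)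
          κ' u' x' z' a b) (cL * ((Lc : ℝ)⁻¹) ^ (n - m)) δL)
    (hLt : ∃ CtL δt : ℝ, 0 < δt ∧ ∀ (r : Fin (3 + 1) → ℕ), r ∈ box (3 + 1) Lc → ∀ n : ℕ,
      LocStencil (fun κ' u' x' z' a b => ((Lc : ℝ) ^ (n + 1 + 1)) ^ (2 * (3 + 1)) * e3OfS (Lc ^ (n + 1 + 1)) (fun κ u =>
        (cΛ * ((Lc : ℝ) ^ (n + 1)) ^ (2 * 3 + 4)) • lagrIncAt 3 (toSite r) Lc (Lc ^ (n + 1)) (Lc ^ (n + 1 + 1)) κ u) κ' u' x' z' a b) CtL δt)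
    (hL0 : ∃ c₀L δ0 : ℝ, 0 ≤ c₀L ∧ 0 < δ0 ∧ ∀ (r : Fin (3 + 1) → ℕ), r ∈ box (3 + 1) Lc → ∀ n : ℕ,
      LocStencil (fun κ' u' x' z' a b => ((Lc : ℝ) ^ (n + 1 + 1)) ^ (2 * (3 + 1)) * e3OfS (Lc ^ (n + 1 + 1)) (fun κ u =>
        (((Lc : ℝ) ^ (3 + 1)) ^ (n + 1) * cΛ) • SLam Lc (lamCoeffOf (KInv (N := Lc) (d := 3)) Lc) (fun μ y => hessFFAt (toSite r) Lc μ y) κ u)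
          κ' u' x' z' a b) (c₀L * ((Lc : ℝ)⁻¹) ^ (n + 1)) δ0)
    (hCg : ∃ C θ δ : ℝ, 0 ≤ C ∧ 0 ≤ θ ∧ θ < 1 ∧ 0 < δ ∧ ∀ (rr : Fin (3 + 1) → ℕ), rr ∈ box (3 + 1) Lc → ∀ k i : ℕ, i < k →
      LocStencil (fun κ' u' => (cE * (Lc : ℝ) ^ (2 * (3 + 1))) ^ (k - i) •
        (push₃ (legChain (respStepBmSeq (toSite rr) Lc) i (k - 1 - i)) (legChain (respStepBmSeq (toSite rr) Lc) i (k - 1 - i))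
            (legChain (respStepBmSeq (toSite rr) Lc) i (k - 1 - i)) (unitS (sfStep Lc i) (smStep 3 Lc i) (freshAt Lc (toSite rr) 0 cΛ i)) κ' u'
          - push₃ (respStep (d := 3) (Lc ^ i) (Lc ^ k)) (respStep (d := 3) (Lc ^ i) (Lc ^ k)) (respStep (d := 3) (Lc ^ i) (Lc ^ k))
            (unitS (sfStep Lc i) (smStep 3 Lc i) (freshAt Lc (toSite rr) 0 cΛ i)) κ' u')) (C * (((k - i : ℕ) : ℝ) ^ p * θ ^ (k - i))) δ) :
    ∃ C δ : ℝ, 0 < δ ∧ ∀ (rr : Fin (3 + 1) → ℕ), rr ∈ box (3 + 1) Lc →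
      ∀ k : ℕ, LocStencil (unitS (sfStep Lc k) (smStep 3 Lc k) (bornSecAt Lc (toSite rr) cE 0 cΛ k)) C δ :=
  exists_hBLam_of_geometric_poly_three cE cΛ p (exists_hUg_of_rootedRows hLc hcE cΛ hL hLt hL0) hCg

end Summit.QuantumFields.BalabanUV.Beta.GAN24.BornLambdaUndressedRow

end
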